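import Summits.BirchSwinnertonDyer.BirchSwinnertonDyer.Theorems.PrintX11aLowerHalfThreePartnerTheoremB
import Summits.BirchSwinnertonDyer.BirchSwinnertonDyer.Theorems.PrintX11aLowerHalfOfChildrenMemberThree
import HarnessLib

/-!
# Crux `X11aLowerHalf` (item stmt-BirchSwinnertonDyer-19064; routes `PrintX11a` rank 2 ∕ `ErratumRoadFive` rank 5) and the leaf
# `WAllCornerX11a` from the children of line «birth» r13 — the lead's r12 (MEMBER currency for the très-ramifié core) with the
# partner-road bundle RE-CUT TO THREE named facts — the r13 children glue
# (width seat bsd-line-er5-p2 = -w3, p = 3 binder, gen 7; `--supports stmt-BirchSwinnertonDyer-19064` helper)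

HONEST FRAMING.  Four composition theorems; no definition, no named fact minted, no `sorry`.  Every theorem is CONDITIONAL and
closes NOTHING: each hypothesis is DISPLAYED — twenty-four statement-only named published facts (never proved; Skinner–Urban 3.6.4
(ram) rational carries the cell's counting flag `SU14-12.3.6-mu@nonsplit@3`; the two remaining Emerton–Pollack–Weston odd-prime
instances and Yan–Zhu Thm. 4.9 carry the disclosure tokens `EPW06@3-Hida-control` ∕ `YZ26@3-BF-ERL-Ohta`), K2's OPEN item 19948,
Greenberg's analytic `μ = 0` on the deep SURJECTIVE X11a pairs at `p ≥ 5` (OPEN) and the rational cyclotomic main-conjecture equality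
at `3` for a member of `H(E[3])` on the très-ramifié off-Kodaira deep X11a pairs (`hM`, THE OPEN CORE in member currency).  The gate records a `conditional-result`; the leaf `WAllCornerX11a` is an OPEN `@[conjecture]`
and is NOT proved; BSD is proved for no curve and no class; PARTITION 0.  beyond-print theorem: no.

## What and why

Of the five partner-road facts of r10's `stub_partnerFactsLower`, TWO are not needed on this line: the period unit at the good prime `3`
is Mazur Cor. 4.1 (conjunct 9 of the shared nine; T21 p637825, r11), and the Emerton–Pollack–Weston `∗ = an` transfer mult ⟶ good
(`thm1_muAn_transfer_goodOrdinary_of_mult_odd`) is superseded by a THEOREM of the tree — Greenberg's analytic `μ₃ = 0` at every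
good-ordinary curve with irreducible `3`-torsion (LINE `theoremB-x10b`, crux 20682 `PrintX10b.AnalyticMuZeroX10b`, CLOSED; class-free
form `ThreePartner.exists_norm_coeff_padicLFunction_eq_one_of_goodOrdinary_three`, file `PrintX11aLowerHalfThreePartnerTheoremB.lean`).
The lead bsd-line-x11a-p1 g4 registered r12 (sha16 c8c39ece6e5271fb): r11 with the très-ramifié open core RE-CUT into MAIN-CONJECTURE
currency — the research stub `stub_memberRatEqAtTresRamifieThree` («some 3-ordinary member of `H(E[3])` has the rational cyclotomic main-
conjecture equality at 3», X. Wan's Thm. 4 shape at `p = 3`), the lower-half text being a THEOREM through er5-p2 g6's door (p634533) —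
glue `x11aLowerHalf_of_children_r12` (p639739, FOUR partner facts).  r13 = r12 with the partner bundle re-cut to THREE conjuncts

  `stub_threePartnerFactsLower : cor514_transfer_of_goodOrdinary_odd ∧ YanZhu2026.thm49_charIdeal_eq_padicLFunction ∧
     thm1_muAlg_transfer_goodOrdinary_of_mult_odd`

(skeleton composition switched to `ThreePartner.x11aLowerHalf_of_printFactsLower_of_threePartnerFacts_of_muAnFive_of_partner_of_tresRamifie`,
p639703; registration by the lead), and this file is the matching children glue, seventh slot = the lead's r12 MEMBER text `hM` (through
`Birth.lowerTresRamifieThree_of_memberRatEqAt_of_nineFactsOddGS_of_elevenFacts`, p639739):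

* `Birth.x11aLowerHalf_of_children_r13 : (U3 nine) → (eleven) → (SU 3.6.4 (ram)) → (THREE partner facts) →
     Theses.ErratumRoadFive.NonSurjCornerTwinMuAn → (stub_muAnSurjDeepFive) → (stub_memberRatEqAtTresRamifieThree) → Theses.PrintX11a.X11aLowerHalf`
  and its `ErratumRoadFive` spelling;
* `PrintX11aLeaf.cruxes_of_children_r13` ∕ `PrintX11aLeaf.wAllCornerX11a_of_children_r13` — the lead's leaf displays with the same re-cut.

Counting (INPUTS-LIST-2 ADD-15 §B convention): distinct named facts displayed on 19064's line 26 (r10) → 25 (r11, r12) → 24 (r13);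
on the leaf display 27 → 26 → 25.  Closing recipe once children are filed with these exact statements (19948 exists):
`theorem X11aLowerHalf_holds : Theses.PrintX11a.X11aLowerHalf := Birth.x11aLowerHalf_of_children_r13 C_nine C_eleven C_ram C_facts3 C_19948 C_surj C_member`
(`--workitem stmt-BirchSwinnertonDyer-19064`).  Nothing here is new mathematics beyond the tree; no summit statement is proved by this seat.

References: [MazurTateTeitelbaum1986Invent] §I.10–I.13; [Mazur1978] Cor. 4.1; [GreenbergVatsal2000] §3 Remark (3.4), Prop. (3.7);
[SkinnerUrban2014] §3.6.7 (p. 45), Thm. 3.6.4 (p. 43); [EmertonPollackWeston2006] Thm. 1, Thm. 3.1.1, Thm. 5.1.3, Cor. 5.1.4;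
[YanZhu2024MainConjNonCM] Thm. 4.9; [Wan2015] Thm. 4; [Kato2004Asterisque] Thm. 12.4, §17.13; [SteinWuthrich2013] Thm. 6.1;
[Wuthrich2014] Prop. 21, Lemma 20; [GreenbergLNM1716] Conj. 1.11; [BalakrishnanEtAl2019] Thm. 1.2; [Miller2011LMS] Def. 1.1;
cell files `Cruxes/X11aLowerHalf/Lines/birth.lean` (r10), `LEAD-g3-VERDICT.md`, `Cruxes/AnalyticMuZeroX10b/Lines/theoremB_x10b.lean`.
-/

set_option autoImplicit false
set_option linter.dupNamespace false -- the directory name repeats the summit name (sibling precedent)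

noncomputable section

open scoped Classical

open WeierstrassCurve IsDedekindDomain Rat.HeightOneSpectrum
  Literature.NumberTheory.EllipticCurves
  Literature.NumberTheory.EllipticCurves.ModularForms
  Literature.NumberTheory.EllipticCurves.Rank1Residual
  Literature.NumberTheory.EllipticCurves.Rank1Residual.Typed
  Literature.NumberTheory.EllipticCurves.Wuthrich2014
  Literature.NumberTheory.EllipticCurves.SteinWuthrich2013
  Literature.NumberTheory.EllipticCurves.Greenberg1999
  Literature.NumberTheory.EllipticCurves.Kato2004
  Literature.NumberTheory.EllipticCurves.GreenbergVatsal2000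
  Literature.NumberTheory.EllipticCurves.EmertonPollackWeston2006
  Literature.NumberTheory.EllipticCurves.SkinnerUrban2014
  Literature.NumberTheory.EllipticCurves.BalakrishnanEtAl2019
  Summit.BirchSwinnertonDyer.Rank1Residual
  Summit.BirchSwinnertonDyer.BirchSwinnertonDyer.Theorems.OddChain

namespace Summit.BirchSwinnertonDyer.BirchSwinnertonDyer.Theorems.Birth

/-- **Crux L BY NAME from the seven children of line «birth» r12 — r10 with the partner-road bundle RE-CUT to THREE named facts**
(Emerton–Pollack–Weston Cor. 5.1.4 and Thm. 1 alg at an odd prime [token EPW06@3-Hida-control], Yan–Zhu 2026 Thm. 4.9 rational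
[token YZ26@3-BF-ERL-Ohta]); the period unit at `3` is Mazur Cor. 4.1 = conjunct 9 of `h9`, and Greenberg's analytic `μ₃ = 0` at the
good-ordinary partner is the tree's THEOREM (LINE theoremB-x10b).  Proof: r8's twenty-two-fact bundle reassembled from `h9`, `h11`, Wuthrich
Lemma 20 FROM THE TREE and `hR`; the both-images certificate at `p ≥ 5` from `h48` + `hS` (lead g1's
`muAnDeepFive_of_nonSurjCornerTwinMuAn_of_surjDeep`, modulo BDMTV ∈ `h11`); the partner on the finite-flat locus = `Birth.stub_partnerThree`
(p632020); then `ThreePartner.x11aLowerHalf_of_printFactsLower_of_threePartnerFacts_of_muAnFive_of_partner_of_tresRamifie`.  CONDITIONAL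
(the gate records a `conditional-result`; closes nothing; BSD is proved for no curve and no class).  Hypotheses VERBATIM the registered
texts of r10 except `hQ3` (the proposed r12 stub `stub_threePartnerFactsLower`).  Closing recipe:
`X11aLowerHalf_holds := x11aLowerHalf_of_children_r13 C_nine C_eleven C_ram C_facts3 C_19948 C_surj C_tres`.
[cite: EmertonPollackWeston2006, Thm. 1, Cor. 5.1.4 (arXiv:math/0404484 pp. 2, 30)] [cite: Mazur1978, Cor. 4.1] [cite: MazurTateTeitelbaum1986Invent, §I.10–I.13]
[cite: SkinnerUrban2014, Thm. 3.6.4 (p. 43)] [cite: GreenbergLNM1716, §1 Conj. 1.11 (p. 61)] [cite: Miller2011LMS, Def. 1.1 (arXiv:1010.2431 p. 3)] -/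
theorem x11aLowerHalf_of_children_r13
    (h9 : thm61_splitMultiplicative ∧ thm61_nonsplitMultiplicative ∧
      (∀ (W : WeierstrassCurve ℚ) [W.IsElliptic] [W.IsGloballyMinimal] (p : ℕ) [Fact p.Prime],
        p ≠ 2 → greenberg_stevens (W := W) (p := p)) ∧
      Kato2004.thm12_4 ∧ exists_isNewformOf ∧
      Kato2004.exists_multDivisibilityInputs_nonsplit_contra ∧
      Kato2004.exists_multDivisibilityInputs_split_contra ∧
      Kato2004.exists_multDivisibilityInputs_fine_contra ∧ mazur_not_dvd_maninConstant_of_odd)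
    (h11 : thm311_cotorsion_weightK_member_ofLevel_odd ∧ thm1_muAlg_of_weightK_member_ofLevel_odd ∧
      Wan2015.thm4_rational_weightK_member_of_bdd_ofLevel_irred ∧
      thm513_transfer_from_weightK_member_of_bdd_ofLevel_odd ∧
      DeligneSerre1974.thm61_exists_adicGaloisRep ∧ Hida2000_thm326_ordinary ∧
      kato_charIdeal_dvd_multiplicative_of_surjective ∧
      rank_eq_analyticRank_of_analyticRank_le_one ∧
      thm12_not_le_normalizer_splitCartan ∧
      ribet1990_levelLowering_gamma0_newform_at_three_additiveDrop ∧
      carayolLivne_additivePrime_dvd_level_of_congruent_newform)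
    (hR : thm364_rational_weightK_member_of_bdd_ofLevel_ram)
    (hQ3 : cor514_transfer_of_goodOrdinary_odd ∧ YanZhu2026.thm49_charIdeal_eq_padicLFunction ∧
      thm1_muAlg_transfer_goodOrdinary_of_mult_odd)
    (h48 : Summit.BirchSwinnertonDyer.BirchSwinnertonDyer.Theses.ErratumRoadFive.NonSurjCornerTwinMuAn)
    (hS : ∀ (W : WeierstrassCurve ℚ) [W.IsElliptic] [W.IsGloballyMinimal] (p : ℕ) [Fact p.Prime],
      ClassX11a W p → 5 ≤ p → Surj W p → ¬ X11a.ShaAnUnit W p → X11a.MuAnZeroAt W p)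
    (hM : ∀ (W : WeierstrassCurve ℚ) [W.IsElliptic] [W.IsGloballyMinimal] (p : ℕ) [Fact p.Prime],
      ClassX11a W p → p = 3 → ¬ X11a.ShaAnUnit W p →
      ¬ (Surj W p ∧ ∃ v : HeightOneSpectrum ℤ, W.HasAdditiveReductionAt v ∧
          3 ∣ (W.kodairaSymbolAt v).componentGroupOrder ∧ ¬ natGenerator v ^ 3 ∣ W.conductorNorm ℤ) →
      ¬ p ∣ padicValInt p W.minimalDiscriminantInt → MemberRatEqAt W p) :
    Summit.BirchSwinnertonDyer.BirchSwinnertonDyer.Theses.PrintX11a.X11aLowerHalf := by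
  -- r8's twenty-two-fact bundle = the twenty (from U3's nine + L's eleven) + Wuthrich Lemma 20 FROM THE TREE + the (ram) fact
  obtain ⟨hNf, h311, hT1a, hWan, hT1b, h61, h326, hKato, h12, hns', hsp', hfine', hMz, hJs, hJn, hGZK, hGS, hB, hRb, hCL⟩ :=
    twentyFactsLower_of_nineFactsOddGS_of_elevenFacts h9 h11
  exact ThreePartner.x11aLowerHalf_of_printFactsLower_of_threePartnerFacts_of_muAnFive_of_partner_of_tresRamifie
    ⟨hNf, h311, hT1a, hWan, hT1b, h61, h326, hKato, Wuthrich2014.lemma20_surjective_threeAdic_of_semistable_holds, h12, hns', hsp',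
      hfine', hMz, hJs, hJn, hGZK, hGS, hB, hRb, hR, hCL⟩
    hQ3 (muAnDeepFive_of_nonSurjCornerTwinMuAn_of_surjDeep hB h48 hS) stub_partnerThree
    (lowerTresRamifieThree_of_memberRatEqAt_of_nineFactsOddGS_of_elevenFacts h9 h11 hM)

/-- The `ErratumRoadFive` spelling of the seven-children glue r12 (one statement under two route names, `Iff.rfl`).
[cite: Miller2011LMS, Def. 1.1 (arXiv:1010.2431 p. 3)] [cite: Mazur1978, Cor. 4.1] -/
theorem x11aLowerHalf_erratumRoadFive_of_children_r13
    (h9 : thm61_splitMultiplicative ∧ thm61_nonsplitMultiplicative ∧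
      (∀ (W : WeierstrassCurve ℚ) [W.IsElliptic] [W.IsGloballyMinimal] (p : ℕ) [Fact p.Prime],
        p ≠ 2 → greenberg_stevens (W := W) (p := p)) ∧
      Kato2004.thm12_4 ∧ exists_isNewformOf ∧
      Kato2004.exists_multDivisibilityInputs_nonsplit_contra ∧
      Kato2004.exists_multDivisibilityInputs_split_contra ∧
      Kato2004.exists_multDivisibilityInputs_fine_contra ∧ mazur_not_dvd_maninConstant_of_odd)
    (h11 : thm311_cotorsion_weightK_member_ofLevel_odd ∧ thm1_muAlg_of_weightK_member_ofLevel_odd ∧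
      Wan2015.thm4_rational_weightK_member_of_bdd_ofLevel_irred ∧
      thm513_transfer_from_weightK_member_of_bdd_ofLevel_odd ∧
      DeligneSerre1974.thm61_exists_adicGaloisRep ∧ Hida2000_thm326_ordinary ∧
      kato_charIdeal_dvd_multiplicative_of_surjective ∧
      rank_eq_analyticRank_of_analyticRank_le_one ∧
      thm12_not_le_normalizer_splitCartan ∧
      ribet1990_levelLowering_gamma0_newform_at_three_additiveDrop ∧
      carayolLivne_additivePrime_dvd_level_of_congruent_newform)
    (hR : thm364_rational_weightK_member_of_bdd_ofLevel_ram)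
    (hQ3 : cor514_transfer_of_goodOrdinary_odd ∧ YanZhu2026.thm49_charIdeal_eq_padicLFunction ∧
      thm1_muAlg_transfer_goodOrdinary_of_mult_odd)
    (h48 : Summit.BirchSwinnertonDyer.BirchSwinnertonDyer.Theses.ErratumRoadFive.NonSurjCornerTwinMuAn)
    (hS : ∀ (W : WeierstrassCurve ℚ) [W.IsElliptic] [W.IsGloballyMinimal] (p : ℕ) [Fact p.Prime],
      ClassX11a W p → 5 ≤ p → Surj W p → ¬ X11a.ShaAnUnit W p → X11a.MuAnZeroAt W p)
    (hM : ∀ (W : WeierstrassCurve ℚ) [W.IsElliptic] [W.IsGloballyMinimal] (p : ℕ) [Fact p.Prime],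
      ClassX11a W p → p = 3 → ¬ X11a.ShaAnUnit W p →
      ¬ (Surj W p ∧ ∃ v : HeightOneSpectrum ℤ, W.HasAdditiveReductionAt v ∧
          3 ∣ (W.kodairaSymbolAt v).componentGroupOrder ∧ ¬ natGenerator v ^ 3 ∣ W.conductorNorm ℤ) →
      ¬ p ∣ padicValInt p W.minimalDiscriminantInt → MemberRatEqAt W p) :
    Summit.BirchSwinnertonDyer.BirchSwinnertonDyer.Theses.ErratumRoadFive.X11aLowerHalf :=
  x11aLowerHalf_of_children_r13 h9 h11 hR hQ3 h48 hS hM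

end Summit.BirchSwinnertonDyer.BirchSwinnertonDyer.Theorems.Birth

namespace Summit.BirchSwinnertonDyer.BirchSwinnertonDyer.Theorems.PrintX11aLeaf

/-- **Route `PrintX11a`'s three open cruxes — L (19064), U3 (20613), U5 (20614) — and the parent 20406, BY NAME, from the seven
children of line «birth» r12** (= the lead's `cruxes_of_children_r12`, p639739, with the partner bundle re-cut to THREE facts: L by
`Birth.x11aLowerHalf_of_children_r13`, U3 by `upperNonSurjThree_of_nineFacts_oddGS_glue` (p625569) from `h9` alone, U5 and the parent by
`upperNonSurjFive_of_nonSurjCornerTwinMuAn_of_nineFactsOddGS_glue₃` ∕ `x11aNonSurjEulerHalf_of_nonSurjCornerTwinMuAn_of_nineFactsOddGS`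
(p630615)).  CONDITIONAL; closes nothing; BSD is proved for no curve.
[cite: GreenbergLNM1716, §1 Conj. 1.11 (p. 61)] [cite: Kato2004Asterisque, Thm. 12.4 (p. 221), §17.13 (pp. 279–280)]
[cite: SteinWuthrich2013, Thm. 6.1 (p. 20)] [cite: BalakrishnanEtAl2019, §1 Thm. 1.2] [cite: MazurTateTeitelbaum1986Invent, §I.10–I.13] -/
theorem cruxes_of_children_r13
    (h9 : thm61_splitMultiplicative ∧ thm61_nonsplitMultiplicative ∧
      (∀ (W : WeierstrassCurve ℚ) [W.IsElliptic] [W.IsGloballyMinimal] (p : ℕ) [Fact p.Prime],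
        p ≠ 2 → greenberg_stevens (W := W) (p := p)) ∧
      Kato2004.thm12_4 ∧ exists_isNewformOf ∧
      Kato2004.exists_multDivisibilityInputs_nonsplit_contra ∧
      Kato2004.exists_multDivisibilityInputs_split_contra ∧
      Kato2004.exists_multDivisibilityInputs_fine_contra ∧ mazur_not_dvd_maninConstant_of_odd)
    (h11 : thm311_cotorsion_weightK_member_ofLevel_odd ∧ thm1_muAlg_of_weightK_member_ofLevel_odd ∧
      Wan2015.thm4_rational_weightK_member_of_bdd_ofLevel_irred ∧
      thm513_transfer_from_weightK_member_of_bdd_ofLevel_odd ∧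
      DeligneSerre1974.thm61_exists_adicGaloisRep ∧ Hida2000_thm326_ordinary ∧
      kato_charIdeal_dvd_multiplicative_of_surjective ∧
      rank_eq_analyticRank_of_analyticRank_le_one ∧
      thm12_not_le_normalizer_splitCartan ∧
      ribet1990_levelLowering_gamma0_newform_at_three_additiveDrop ∧
      carayolLivne_additivePrime_dvd_level_of_congruent_newform)
    (hR : thm364_rational_weightK_member_of_bdd_ofLevel_ram)
    (hQ3 : cor514_transfer_of_goodOrdinary_odd ∧ YanZhu2026.thm49_charIdeal_eq_padicLFunction ∧
      thm1_muAlg_transfer_goodOrdinary_of_mult_odd)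
    (h48 : Summit.BirchSwinnertonDyer.BirchSwinnertonDyer.Theses.ErratumRoadFive.NonSurjCornerTwinMuAn)
    (hS : ∀ (W : WeierstrassCurve ℚ) [W.IsElliptic] [W.IsGloballyMinimal] (p : ℕ) [Fact p.Prime],
      ClassX11a W p → 5 ≤ p → Surj W p → ¬ X11a.ShaAnUnit W p → X11a.MuAnZeroAt W p)
    (hM : ∀ (W : WeierstrassCurve ℚ) [W.IsElliptic] [W.IsGloballyMinimal] (p : ℕ) [Fact p.Prime],
      ClassX11a W p → p = 3 → ¬ X11a.ShaAnUnit W p →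
      ¬ (Surj W p ∧ ∃ v : HeightOneSpectrum ℤ, W.HasAdditiveReductionAt v ∧
          3 ∣ (W.kodairaSymbolAt v).componentGroupOrder ∧ ¬ natGenerator v ^ 3 ∣ W.conductorNorm ℤ) →
      ¬ p ∣ padicValInt p W.minimalDiscriminantInt → MemberRatEqAt W p) :
    Summit.BirchSwinnertonDyer.BirchSwinnertonDyer.Theses.PrintX11a.X11aLowerHalf ∧
      Summit.BirchSwinnertonDyer.BirchSwinnertonDyer.Theses.PrintX11a.UpperNonSurjThree ∧
      Summit.BirchSwinnertonDyer.BirchSwinnertonDyer.Theses.PrintX11a.UpperNonSurjFive ∧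
      Summit.BirchSwinnertonDyer.BirchSwinnertonDyer.Theses.PrintX11a.X11aNonSurjEulerHalf := by
  obtain ⟨hJs, hJn, hGS, h12, hnf, hns', hsp', hfine', hMz⟩ := h9
  have hB : thm12_not_le_normalizer_splitCartan := h11.2.2.2.2.2.2.2.2.1
  exact ⟨Birth.x11aLowerHalf_of_children_r13 ⟨hJs, hJn, hGS, h12, hnf, hns', hsp', hfine', hMz⟩ h11 hR hQ3 h48 hS hM,
    upperNonSurjThree_of_nineFacts_oddGS_glue ⟨hJs, hJn, hGS, h12, hnf, hns', hsp', hfine', hMz⟩,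
    upperNonSurjFive_of_nonSurjCornerTwinMuAn_of_nineFactsOddGS_glue₃ h48 hB ⟨hJs, hJn, hGS, h12, hnf, hns', hsp', hfine', hMz⟩,
    x11aNonSurjEulerHalf_of_nonSurjCornerTwinMuAn_of_nineFactsOddGS hB h48 hJs hJn hGS h12 hnf hns' hsp' hfine' hMz⟩

/-- **The registered leaf `WAllCornerX11a` (rung W-ALL ∕ 11) DISPLAYED modulo the seven children of line «birth» r12 and Wuthrich
2014 Prop. 21** (= the lead's `wAllCornerX11a_of_children_r12`, p639739, with the partner bundle re-cut to THREE facts): in the kernel the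
class theorem of leaf X11a holds MODULO twenty-five named published facts (one flagged SU14-12.3.6@3; EPW Cor. 5.1.4 ∕ Thm. 1 alg and
Yan–Zhu 4.9 with @3 tokens), K2's item 19948 and two OPEN statements (`hS`, `hM`).  CONDITIONAL: the conclusion is an OPEN `@[conjecture]`
leaf and is NOT proved here; the gate records a `conditional-result`; PARTITION 0; BSD is proved for no class.
[cite: Miller2011LMS, Def. 1.1 (arXiv:1010.2431 p. 3)] [cite: Wuthrich2014, Prop. 21 (p. 400)] [cite: Mazur1978, Cor. 4.1]
[cite: GreenbergLNM1716, §1 Conj. 1.11 (p. 61)] [cite: SkinnerUrban2014, Thm. 3.6.4 (p. 43)] -/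
theorem wAllCornerX11a_of_children_r13
    (h9 : thm61_splitMultiplicative ∧ thm61_nonsplitMultiplicative ∧
      (∀ (W : WeierstrassCurve ℚ) [W.IsElliptic] [W.IsGloballyMinimal] (p : ℕ) [Fact p.Prime],
        p ≠ 2 → greenberg_stevens (W := W) (p := p)) ∧
      Kato2004.thm12_4 ∧ exists_isNewformOf ∧
      Kato2004.exists_multDivisibilityInputs_nonsplit_contra ∧
      Kato2004.exists_multDivisibilityInputs_split_contra ∧
      Kato2004.exists_multDivisibilityInputs_fine_contra ∧ mazur_not_dvd_maninConstant_of_odd)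
    (h11 : thm311_cotorsion_weightK_member_ofLevel_odd ∧ thm1_muAlg_of_weightK_member_ofLevel_odd ∧
      Wan2015.thm4_rational_weightK_member_of_bdd_ofLevel_irred ∧
      thm513_transfer_from_weightK_member_of_bdd_ofLevel_odd ∧
      DeligneSerre1974.thm61_exists_adicGaloisRep ∧ Hida2000_thm326_ordinary ∧
      kato_charIdeal_dvd_multiplicative_of_surjective ∧
      rank_eq_analyticRank_of_analyticRank_le_one ∧
      thm12_not_le_normalizer_splitCartan ∧
      ribet1990_levelLowering_gamma0_newform_at_three_additiveDrop ∧
      carayolLivne_additivePrime_dvd_level_of_congruent_newform)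
    (hR : thm364_rational_weightK_member_of_bdd_ofLevel_ram)
    (hQ3 : cor514_transfer_of_goodOrdinary_odd ∧ YanZhu2026.thm49_charIdeal_eq_padicLFunction ∧
      thm1_muAlg_transfer_goodOrdinary_of_mult_odd)
    (h48 : Summit.BirchSwinnertonDyer.BirchSwinnertonDyer.Theses.ErratumRoadFive.NonSurjCornerTwinMuAn)
    (hS : ∀ (W : WeierstrassCurve ℚ) [W.IsElliptic] [W.IsGloballyMinimal] (p : ℕ) [Fact p.Prime],
      ClassX11a W p → 5 ≤ p → Surj W p → ¬ X11a.ShaAnUnit W p → X11a.MuAnZeroAt W p)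
    (hM : ∀ (W : WeierstrassCurve ℚ) [W.IsElliptic] [W.IsGloballyMinimal] (p : ℕ) [Fact p.Prime],
      ClassX11a W p → p = 3 → ¬ X11a.ShaAnUnit W p →
      ¬ (Surj W p ∧ ∃ v : HeightOneSpectrum ℤ, W.HasAdditiveReductionAt v ∧
          3 ∣ (W.kodairaSymbolAt v).componentGroupOrder ∧ ¬ natGenerator v ^ 3 ∣ W.conductorNorm ℤ) →
      ¬ p ∣ padicValInt p W.minimalDiscriminantInt → MemberRatEqAt W p)
    (hWu : Wuthrich2014.sha_dvd_analyticSha) :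
    Summit.BirchSwinnertonDyer.WAllCornerX11a := by
  -- as in the lead's `wAllCornerX11a_of_children_r12`: the route's deciding theorem on the two halves and ⟨Prop. 21, GZK, modularity⟩
  obtain ⟨hL, -, -, hE⟩ := cruxes_of_children_r13 h9 h11 hR hQ3 h48 hS hM
  exact Summit.BirchSwinnertonDyer.BirchSwinnertonDyer.Theses.PrintX11a.closes hL hE ⟨hWu, h11.2.2.2.2.2.2.2.1, h9.2.2.2.2.1⟩

end Summit.BirchSwinnertonDyer.BirchSwinnertonDyer.Theorems.PrintX11aLeaf

end
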